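import Summits.BirchSwinnertonDyer.Rank1Residual.X4.KuriharaLevelLoweringOfMultiplicityOne
import Summits.BirchSwinnertonDyer.Rank1Residual.Additive.X4QuadraticTwistCertificate
import HarnessLib

/-!
# TAM-DEFECT₂ on the TWIST-GOOD locus: `BSD(E,p)` from published inputs + mod-`p` multiplicity one and an `ℓ`-old eigensymbol ON THE TWIST (cell `b2b-bsdres`, seat additive-p4 gen 23, line V42 END)

HONEST FRAMING (verbatim, cell `b2b-bsdres`): the goal of the cell is to DELETE the COMBINATION-SHAPED
residual classes for ALL analytic-rank `≤ 1` curves over `ℚ` — "full BSD formula for every rank `≤ 1`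
curve in class `C`" assembled STRICTLY from published theorems — so that the rank-`≤ 1` remainder
becomes exactly the CONSTRUCTION-SHAPED classes, which are TYPED (missing-input Props), NOT attempted;
this is not "finishing BSD". This file: research-route KERNEL COMPOSITION; the two displayed
modular-symbol hypotheses (MO)/(OLD) of `X4/KuriharaLevelLoweringOfMultiplicityOne.lean` are predicates
with parameters, not named facts; nothing is booked; X4 stays CONSTRUCTION-SHAPED.

## What is proved (CLASS-CLOSURE E2 sub-partition of TAM-DEFECT₂, VERBATIM-EXTENSION part)

Let `W/ℚ` be the cell's additive curve at `p` and `W ≅ W₀ ⊗ χ_D` a quadratic twist (`D ≡ 1 (mod 4)`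
square-free, `m = |D| ∣ N_W`), `f_W`, `f₀ = f_{W₀}` the newforms. GEN 21/22 proved the SYMBOL-LEVEL
twist identity `[r]⁺_{f_W} = c₀ Σ_{u mod m} (u/m) [r + u/m]⁺_{f₀}` with ONE `p`-unit `c₀`
(`Additive/QuadraticTwistNewform.lean`, Pal 2012 proved in the tree) and transported a `ℤ/p`-valued
`ℓ`-old identity for `f₀` to the certificate of `W`. Here the `W₀`-side identity is no longer an
instrument output but comes from the two displayed inputs ON `f₀` AT LEVEL `N₀`:

* §1 `plusSymbolLevelLowersOver_of_jacobiTwistFn` — the curve-free transport with a `k`-VALUED old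
  shape `ι(Φ(r) mod p) = μ(r) − w μ(ℓ r)` (`μ : ℚ → k`, `k ⊇ 𝔽_p` a residue field);
* §2 `plusSymbolLevelLowersOver_of_jacobiTwist_of_multiplicityOne` — **(MO) `ModPMultiplicityOne k N₀ θ̄`
  + (OLD) `HasOldEigenPlusSymb k N₀ θ̄ ℓ w μ` for `f₀` ⟹ the certificate `PlusSymbolLevelLowersOver W p f_W ι ℓ`**
  (via gen 23's `exists_oldShape_of_multiplicityOne_twist` and §1);
* §3 **`X4.bsdp_of_multiplicityOne_twist_of_tamagawa_le_two_of_shaAn_unit_of_five_le`** — THE END on a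
  TAM-DEFECT₂ unit row at `p ≥ 5`: analytic rank `0`, `ρ̄_{E,p}` onto, conductor-level datum with
  `p ∤ c_D` and the period transfer, `#Ш_an` a `p`-unit, `ord_p ∏ c ≤ 2` ⟹ **`BSD(E,p)`** from Kim 2026
  Thm. 1.8 (6) + Cassels–Tate + GZK + modularity (PUBLISHED) + (MO)(OLD) on `f₀` + the twist identity;
  and `…_of_pos` — the same with the twist identity DISCHARGED by the tree for `D > 0`
  (`exists_rat_ratPlusSymbol_eq_twistSum_of_pos`, `norm_ratCast_eq_one_of_twist_of_pos`).

WHY THIS IS THE VERBATIM-EXTENSION SUB-CLASS: on the twist-good locus (`e_p(W) = 2`, the minimal twist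
`W₀` GOOD at `p`, so `p ∤ N₀`) both (MO) (Mazur / Ribet 1990 Thm. 5.2 (b) / Wiles 1995 Thm. 2.1,
`p ∤ 2N₀`) and (OLD) (Ribet 1990 Thm. 1.1 at the split multiplicative Tamagawa prime `ℓ ∥ N₀`, where
`ρ̄` is unramified since `p ∣ c_ℓ(W) = v_ℓ(Δ)`, + Ihara) are theorems IN PRINT for `f₀`; the remaining
displayed hypotheses are per-row NUMERALS (twist datum, `ord_p ∏ c`, `#Ш_an`) or published facts.
Census (seat file `gen23-evidence/V42-SUBPARTITION-p5plus.tsv`, zero kit): of the 172 open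
r0 TAM-DEFECT₂ unit cells at `p ≥ 5` (R203 companions), 39 are twist-good (all with odd `D` and a
split multiplicative Tamagawa prime) and 133 are in the corner `e_p ∈ {3,4,6}` where (MO) at `p² ∥ N`
is NOT in print; at `p = 3` (modulo the announced Kim 2025 clause) 479 / 1 888 are twist-good
(463 with a split multiplicative Tamagawa-`3` prime). Nothing booked; labels unchanged.

## References

* K. A. Ribet, Invent. Math. 100 (1990), Thm. 1.1, Thm. 5.2 (b). [cite: Ribet1990, Thm. 1.1 and Thm. 5.2 (b)]
* A. Wiles, Ann. of Math. 141 (1995), Thm. 2.1. [cite: Wiles1995, Thm. 2.1]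
* A. Pál, Canad. J. Math. 64 (2012), Thm. 3.2 with Prop. 2.5. [cite: Pal2012, Thm. 3.2 with Prop. 2.5]
* C.-H. Kim, Amer. J. Math. 148 (2026), Thm. 1.9 (6), Conj. 1.10, §1.2.2, §1.4.3. [cite: Kim2022StructureSelmer, Thm. 1.9 (6) and Conj. 1.10]
* B. Mazur, J. Tate, J. Teitelbaum, Invent. Math. 84 (1986), §I.4 (4.2), §I.8. [cite: MazurTateTeitelbaum1986Invent, §I.4 (4.2) and §I.8]
-/

noncomputable section

open scoped MatrixGroups ModularForm NumberTheorySymbols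

open CongruenceSubgroup Finset IsDedekindDomain NumberField

open Literature.NumberTheory.EllipticCurves Literature.NumberTheory.EllipticCurves.ModularForms
  Summit.BirchSwinnertonDyer.Rank1Residual.LevelLowering

namespace Summit.BirchSwinnertonDyer.Rank1Residual.Additive

variable {k : Type*} [CommRing k] (p : ℕ) [hp : Fact p.Prime] (ι : ZMod p →+* k)

/-! ## §1 Curve-free transport with a `k`-valued old shape -/

section CurveFree

variable (W : WeierstrassCurve ℚ) [W.IsGloballyMinimal] {m : ℕ} [NeZero m] {NW : ℕ}
  (fW : CuspForm (Gamma0 NW) 2)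

/-- **CURVE-FREE TRANSPORT, general modulus, `k`-valued old shape.** `W` globally minimal with
`m ∣ N_W`; `f_W` a cusp form whose plus symbol is `c₀ · ∑_{u mod m} (u/m) Φ(r + u/m)` for a
`p`-integral `Φ : ℚ → ℚ` and a `p`-integral `c₀`; `ι(Φ mod p) = μ − w·μ∘[ℓ]` in `k` with `μ`
periodic and `T_q`-eigen with eigenvalue `ι((q/m)·a_q(W))` at every Kolyvagin prime `q` of `(W, p)`;
`gcd(ℓ, m) = 1`, `w·ι((ℓ/m)) = 1`. Then `PlusSymbolLevelLowersOver W p f_W ι ℓ` (gen 22's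
`plusSymbolLevelLowersAt_of_jacobiTwistFn` with `ℤ/p ↦ k`, via gen 23's
`plusSymbolLevelLowersOver_of_twistSum_fn`). [cite: Kim2022StructureSelmer, §1.2.2 and §1.4.3]
[cite: MazurTateTeitelbaum1986Invent, §I.4 (4.2) and §I.8] -/
theorem plusSymbolLevelLowersOver_of_jacobiTwistFn (hmN : m ∣ W.conductorNorm ℤ) (Φ : ℚ → ℚ)
    (c₀ : ℚ) (hc : ¬ p ∣ c₀.den) (hint : ∀ x : ℚ, ¬ p ∣ (Φ x).den)
    (hsym : ∀ r : ℚ, ratPlusSymbol fW r =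
      c₀ * ∑ u : ZMod m, (J((u.val : ℤ) | m) : ℚ) * Φ (r + (u.val : ℚ) / m))
    {μ : ℚ → k} (hμ : IsPeriodic μ) {w : k} {ℓ : ℕ} (hℓ : ℓ.Coprime m)
    (hV : ∀ r : ℚ, ι ((Φ r : ℚ) : ZMod p) = μ r - w * μ (ℓ * r))
    (hw : w * ι ((J((ℓ : ℤ) | m) : ℤ) : ZMod p) = 1)
    (hH : ∀ q : ℕ, Kato.IsKolyvaginPrime W p 1 q →
      HeckeRel μ q (ι ((J((q : ℤ) | m) : ℤ) : ZMod p) * ι (W.frobeniusTrace q : ZMod p))) :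
    PlusSymbolLevelLowersOver W p fW ι ℓ := by
  set χ : ZMod m →* k := ι.toMonoidHom.comp (jacobiHom p m) with hχdef
  set φ : ℚ → k := fun x ↦ ι ((Φ x : ℚ) : ZMod p) with hφdef
  have hχ : ∀ u : ZMod m, χ u = ι (jacobiHom p m u) := fun u ↦ rfl
  have hsymP : ∀ r : ℚ, ι ((ratPlusSymbol fW r : ℚ) : ZMod p) =
      ι (c₀ : ZMod p) * ∑ u : ZMod m, χ u * φ (r + (u.val : ℚ) / m) := by
    intro r
    rw [ratCast_ratPlusSymbol_eq_jacobiTwistSum p fW Φ c₀ hc hint hsym r, map_mul, map_sum]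
    refine congrArg _ (Finset.sum_congr rfl fun u _ ↦ ?_)
    rw [map_mul, hχ]
  have hℓu : IsUnit ((ℓ : ℕ) : ZMod m) := (ZMod.isUnit_iff_coprime ℓ m).mpr hℓ
  have hχnat : ∀ n : ℕ, χ n = ι ((J((n : ℤ) | m) : ℤ) : ZMod p) := fun n ↦ by
    rw [hχ, jacobiHom_natCast]
  have hχsq : ∀ {n : ℕ}, n.Coprime m → χ n ^ 2 = 1 := fun {n} hn ↦ by
    rw [hχ, ← map_pow, jacobiHom_natCast_sq_eq_one p hn, map_one]
  have hw' : w * χ ℓ = 1 := by rwa [hχnat]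
  refine plusSymbolLevelLowersOver_of_twistSum_fn W p ι χ fW (ι (c₀ : ZMod p)) φ hsymP hμ hV hℓu
    (hχsq hℓ) hw' (fun q ↦ χ q * ι (W.frobeniusTrace q : ZMod p)) fun q hq ↦ ?_
  have hqm : q.Coprime m := by
    refine (Nat.Prime.coprime_iff_not_dvd hq.prime).mpr fun hd ↦ hq.2.1 ?_
    exact (hd.trans hmN).mul_right p
  have hqu : IsUnit ((q : ℕ) : ZMod m) := (ZMod.isUnit_iff_coprime q m).mpr hqm
  refine ⟨?_, hqu, hχsq hqm, ?_⟩
  · rw [hχnat]; exact hH q hq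
  · rw [← mul_assoc, ← sq, hχsq hqm, one_mul]

end CurveFree

/-! ## §2 The certificate of `W` from (MO) + (OLD) for the twist's newform `f₀` -/

section FromPrint

variable (W : WeierstrassCurve ℚ) [W.IsGloballyMinimal] {m : ℕ} [NeZero m] {N₀ NW : ℕ} [NeZero N₀]
  {f₀ : CuspForm (Gamma0 N₀) 2} (fW : CuspForm (Gamma0 NW) 2)

/-- **THE CERTIFICATE OF THE ADDITIVE CURVE FROM THE TWO PUBLISHED INPUTS ON ITS TWIST.** `W`
globally minimal, `m ∣ N_W`; `f₀ ∈ S₂(Γ₀(N₀))` a normalised newform with rational coefficients,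
`Ω⁺_{f₀} ≠ 0`, integer eigenvalues `θ` with `θ(q) ≡ (q/m)·a_q(W) (mod p)` at the Kolyvagin primes of
`(W, p)` (`hθW`; for `W ≅ W₀ ⊗ χ_D`, `f₀ = f_{W₀}`, `m = |D|`, this is `a_q(W₀) = (q/|D|) a_q(W)`),
every `[r]⁺_{f₀}` `p`-integral; the twist identity `[r]⁺_{f_W} = c₀ Σ_u (u/m)[r + u/m]⁺_{f₀}` with
`p`-integral `c₀` (`hsym`, `hc`); and ON `f₀` AT LEVEL `N₀`: **(MO)** `ModPMultiplicityOne k N₀ θ̄` and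
**(OLD)** `HasOldEigenPlusSymb k N₀ θ̄ ℓ w μ` with `μ` periodic and `T_q`-eigen (`θ̄(q)`) at the Kolyvagin
primes, `gcd(ℓ, m) = 1`, `w·ι((ℓ/m)) = 1`. THEN `PlusSymbolLevelLowersOver W p f_W ι ℓ`. Both (MO) and
(OLD) are IN PRINT when `p ∤ 2N₀` and `ρ̄` is absolutely irreducible and unramified at `ℓ ∥ N₀` — the
twist-good locus of the cell's TAM-DEFECT₂ residue. [cite: Ribet1990, Thm. 1.1 and Thm. 5.2 (b)]
[cite: Wiles1995, Thm. 2.1] [cite: Kim2022StructureSelmer, §1.2.2 and §1.4.3] -/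
theorem plusSymbolLevelLowersOver_of_jacobiTwist_of_multiplicityOne (hmN : m ∣ W.conductorNorm ℤ)
    (hf₀ : IsNewform0 f₀) (hQ : coeffField f₀ = ⊥) (hΩ : plusPeriod f₀ ≠ 0)
    (hint : ∀ x : ℚ, ¬ p ∣ (ratPlusSymbol f₀ x).den)
    (θ : ℕ → ℤ) (hθ : ∀ q : ℕ, q.Prime → ((θ q : ℤ) : ℂ) = cuspCoeff f₀ q)
    (hθW : ∀ q : ℕ, Kato.IsKolyvaginPrime W p 1 q →
      ((θ q : ℤ) : ZMod p) = ((J((q : ℤ) | m) : ℤ) : ZMod p) * (W.frobeniusTrace q : ZMod p))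
    (c₀ : ℚ) (hc : ¬ p ∣ c₀.den)
    (hsym : ∀ r : ℚ, ratPlusSymbol fW r =
      c₀ * ∑ u : ZMod m, (J((u.val : ℤ) | m) : ℚ) * ratPlusSymbol f₀ (r + (u.val : ℚ) / m))
    (hMO : ModPMultiplicityOne k N₀ (fun q ↦ ι ((θ q : ℤ) : ZMod p)))
    {ℓ : ℕ} {w : k} {μ : ℚ → k} (hℓ : ℓ.Coprime m)
    (hOLD : HasOldEigenPlusSymb k N₀ (fun q ↦ ι ((θ q : ℤ) : ZMod p)) ℓ w μ) (hμ : IsPeriodic μ)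
    (hH : ∀ q : ℕ, Kato.IsKolyvaginPrime W p 1 q → HeckeRel μ q (ι ((θ q : ℤ) : ZMod p)))
    (hw : w * ι ((J((ℓ : ℤ) | m) : ℤ) : ZMod p) = 1) :
    PlusSymbolLevelLowersOver W p fW ι ℓ := by
  obtain ⟨μ', hμ', hH', hV'⟩ := exists_oldShape_of_multiplicityOne_twist (ι := ι) hf₀ hQ hΩ hint θ hθ
    hMO hOLD hμ (P := Kato.IsKolyvaginPrime W p 1) hH
  refine plusSymbolLevelLowersOver_of_jacobiTwistFn p ι W fW hmN (fun x ↦ ratPlusSymbol f₀ x) c₀ hc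
    hint hsym hμ' hℓ hV' hw fun q hq ↦ ?_
  have h := hH' q hq
  rwa [hθW q hq, map_mul] at h

end FromPrint

end Summit.BirchSwinnertonDyer.Rank1Residual.Additive

/-! ## §3 THE END on a TAM-DEFECT₂ unit row at `p ≥ 5` -/

namespace Summit.BirchSwinnertonDyer.Rank1Residual.X4

open Complex WeierstrassCurve Literature.NumberTheory.EllipticCurves.Rank1Residual
  Literature.NumberTheory.EllipticCurves.Rank1Residual.Typed
  Summit.BirchSwinnertonDyer.Rank1Residual.LevelLowering Summit.BirchSwinnertonDyer.Rank1Residual.Additive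

variable {k : Type*} [CommRing k] [Nontrivial k]
  (W : WeierstrassCurve ℚ) [W.IsElliptic] [W.IsGloballyMinimal] (p : ℕ) [Fact p.Prime]
  (ι : ZMod p →+* k)

/-- **TAM-DEFECT₂ ON THE TWIST-GOOD LOCUS, `p ≥ 5`: `BSD(E,p)` from PUBLISHED inputs + (MO)(OLD) ON THE
TWIST.** For `W/ℚ` globally minimal of analytic rank `0`, `p ≥ 5` with `ρ̄_{E,p}` onto (ADDITIVE at `p`
allowed), a conductor-level datum `D` with `p ∤ c_D` and the period transfer, `#Ш_an = q'` a `p`-unit,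
`ord_p ∏_v c_v ≤ 2`; a modulus `m ∣ N_E` and a rational newform `f₀` of level `N₀` (the twist
`W₀ = E ⊗ χ`, `p ∤ N₀` on the twist-good locus) with the twist identity
`[r]⁺_{D.f} = c₀ Σ_u (u/m)[r + u/m]⁺_{f₀}` (`p`-integral `c₀`), integer eigenvalues `θ` matching
`(q/m)·a_q(E)` at the Kolyvagin primes, `p`-integral symbols; and the two displayed inputs ON `f₀`:
(MO) `ModPMultiplicityOne k N₀ θ̄`, (OLD) `HasOldEigenPlusSymb k N₀ θ̄ ℓ w μ` at some `ℓ ∣ N_E`,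
`gcd(ℓ, m) = 1`, `w·ι((ℓ/m)) = 1`, `μ` periodic and `T_q`-eigen. THEN **`BSD(E,p)`**. Inputs by name:
Kim 2026 Thm. 1.8 (6) (`hKimk`, `hE67c`), Cassels–Tate (`hCT`), GZK (`hGZK`), modularity (`hmod`) —
PUBLISHED; (MO)/(OLD) — IN PRINT when `p ∤ 2N₀` (Mazur–Ribet–Wiles; Ribet + Ihara). Census: 39 of the
172 open r0 TAM-DEFECT₂ unit cells at `p ≥ 5` are on this locus. Nothing booked; X4 CONSTRUCTION-SHAPED.
[cite: Kim2022StructureSelmer, Thm. 1.9 (6) and Conj. 1.10 (PDF p. 8)] [cite: SilvermanAEC2009, Thm. X.4.14]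
[cite: Ribet1990, Thm. 1.1 and Thm. 5.2 (b)] [cite: Wiles1995, Thm. 2.1] [cite: Miller2011LMS, §1 and Def. 1.1] -/
theorem bsdp_of_multiplicityOne_twist_of_tamagawa_le_two_of_shaAn_unit_of_five_le
    (hKimk : Kim2026.rankZero_le_padicValNat_sha_of_kuriharaNumber_ne_zero)
    (hE67c : Kim2026.rankZero_padicValNat_sha_add_le_of_forall_pow_dvd_kuriharaNumber_cyclicLevel)
    (hCT : exists_casselsTate_pairing (K := ℚ))
    (hGZK : rank_eq_analyticRank_of_analyticRank_le_one) (hmod : hasEntireLFunction_rat)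
    (hp : 5 ≤ p) (hr : W.analyticRank = 0) (hsurj : W.HasSurjectiveModNGaloisRep p)
    {N : ℕ} [NeZero N] (D : ModularParametrizationData W N) (hN : W.conductorNorm ℤ = N)
    (hc : ¬ (p : ℤ) ∣ D.maninConstant)
    (hper : ∃ u : ℚ, ‖(u : ℚ_[p])‖ = 1 ∧ W.realPeriodRat = u * plusPeriod D.f)
    {q' : ℚ} (hq' : shaAn W = (q' : ℂ)) (hv : padicValRat p q' = 0)
    (hc2 : padicValNat p W.tamagawaProduct ≤ 2)
    -- the twist and its newform
    {m : ℕ} [NeZero m] (hmN : m ∣ W.conductorNorm ℤ) {N₀ : ℕ} [NeZero N₀] {f₀ : CuspForm (Gamma0 N₀) 2}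
    (hf₀ : IsNewform0 f₀) (hQ : coeffField f₀ = ⊥) (hΩ : plusPeriod f₀ ≠ 0)
    (hint : ∀ x : ℚ, ¬ p ∣ (ratPlusSymbol f₀ x).den)
    (θ : ℕ → ℤ) (hθ : ∀ q : ℕ, q.Prime → ((θ q : ℤ) : ℂ) = cuspCoeff f₀ q)
    (hθW : ∀ q : ℕ, Kato.IsKolyvaginPrime W p 1 q →
      ((θ q : ℤ) : ZMod p) = ((J((q : ℤ) | m) : ℤ) : ZMod p) * (W.frobeniusTrace q : ZMod p))
    (c₀ : ℚ) (hc₀ : ¬ p ∣ c₀.den)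
    (hsym : ∀ r : ℚ, ratPlusSymbol D.f r =
      c₀ * ∑ u : ZMod m, (J((u.val : ℤ) | m) : ℚ) * ratPlusSymbol f₀ (r + (u.val : ℚ) / m))
    -- the two displayed inputs on `f₀`
    (hMO : ModPMultiplicityOne k N₀ (fun q ↦ ι ((θ q : ℤ) : ZMod p)))
    {ℓ : ℕ} {w : k} {μ : ℚ → k} (hℓN : ℓ ∣ W.conductorNorm ℤ) (hℓ : ℓ.Coprime m)
    (hOLD : HasOldEigenPlusSymb k N₀ (fun q ↦ ι ((θ q : ℤ) : ZMod p)) ℓ w μ) (hμ : IsPeriodic μ)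
    (hH : ∀ q : ℕ, Kato.IsKolyvaginPrime W p 1 q → HeckeRel μ q (ι ((θ q : ℤ) : ZMod p)))
    (hw : w * ι ((J((ℓ : ℤ) | m) : ℤ) : ZMod p) = 1) : BSDp W p :=
  bsdp_of_plusSymbolLevelLowersOver_of_tamagawa_le_two_of_shaAn_unit_of_five_le W p hKimk hE67c hCT
    hGZK hmod hp hr hsurj D hN hc hper hq' hv
    (plusSymbolLevelLowersOver_of_jacobiTwist_of_multiplicityOne p ι W D.f hmN hf₀ hQ hΩ hint θ hθ
      hθW c₀ hc₀ hsym hMO hℓ hOLD hμ hH hw) hℓN hc2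

/-- **The `p ≥ 3` tower twin, CONDITIONAL on the announced Kim 2025 clause** (`hK25s`, flag
`Kim2025-preprint`): the same composition on a unit TAM-DEFECT₂ TOWER row; at `p = 3` this is the
twist-good part of the N11 TAM-DEFECT₂(3) block (`W₀ = E^{(−3)}`-type or general odd `D`, `3 ∤ N₀`;
census: 479 of 1 888 open cells, 463 with a split multiplicative Tamagawa-`3` prime).
[claim: Kim2025RefinedTNC, status: under-review]
[cite: Kim2025RefinedTNC, Thm. 1.1 ("BSD") (ANNOUNCED, OPEN binder)] [cite: Ribet1990, Thm. 1.1 and Thm. 5.2 (b)]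
[cite: SilvermanAEC2009, Thm. X.4.14] [cite: Miller2011LMS, §1 and Def. 1.1] -/
theorem bsdp_of_multiplicityOne_twist_of_tamagawa_le_two_of_shaAn_unit_of_kim2025_OPEN
    (hK25s : Kim2025.thm11_kimShaLength_of_integralPeriod_OPEN)
    (hCT : exists_casselsTate_pairing (K := ℚ))
    (hGZK : rank_eq_analyticRank_of_analyticRank_le_one) (hmod : hasEntireLFunction_rat)
    (hp3 : 3 ≤ p) (hr : W.analyticRank = 0) (htower : ∀ n : ℕ, W.HasSurjectiveModNGaloisRep (p ^ n : ℕ))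
    {N : ℕ} [NeZero N] (D : ModularParametrizationData W N) (hN : W.conductorNorm ℤ = N)
    (hper : ∃ u : ℚ, ‖(u : ℚ_[p])‖ = 1 ∧ W.realPeriodRat = u * plusPeriod D.f)
    {q' : ℚ} (hq' : shaAn W = (q' : ℂ)) (hv : padicValRat p q' = 0)
    (hc2 : padicValNat p W.tamagawaProduct ≤ 2)
    {m : ℕ} [NeZero m] (hmN : m ∣ W.conductorNorm ℤ) {N₀ : ℕ} [NeZero N₀] {f₀ : CuspForm (Gamma0 N₀) 2}
    (hf₀ : IsNewform0 f₀) (hQ : coeffField f₀ = ⊥) (hΩ : plusPeriod f₀ ≠ 0)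
    (hint : ∀ x : ℚ, ¬ p ∣ (ratPlusSymbol f₀ x).den)
    (θ : ℕ → ℤ) (hθ : ∀ q : ℕ, q.Prime → ((θ q : ℤ) : ℂ) = cuspCoeff f₀ q)
    (hθW : ∀ q : ℕ, Kato.IsKolyvaginPrime W p 1 q →
      ((θ q : ℤ) : ZMod p) = ((J((q : ℤ) | m) : ℤ) : ZMod p) * (W.frobeniusTrace q : ZMod p))
    (c₀ : ℚ) (hc₀ : ¬ p ∣ c₀.den)
    (hsym : ∀ r : ℚ, ratPlusSymbol D.f r =
      c₀ * ∑ u : ZMod m, (J((u.val : ℤ) | m) : ℚ) * ratPlusSymbol f₀ (r + (u.val : ℚ) / m))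
    (hMO : ModPMultiplicityOne k N₀ (fun q ↦ ι ((θ q : ℤ) : ZMod p)))
    {ℓ : ℕ} {w : k} {μ : ℚ → k} (hℓN : ℓ ∣ W.conductorNorm ℤ) (hℓ : ℓ.Coprime m)
    (hOLD : HasOldEigenPlusSymb k N₀ (fun q ↦ ι ((θ q : ℤ) : ZMod p)) ℓ w μ) (hμ : IsPeriodic μ)
    (hH : ∀ q : ℕ, Kato.IsKolyvaginPrime W p 1 q → HeckeRel μ q (ι ((θ q : ℤ) : ZMod p)))
    (hw : w * ι ((J((ℓ : ℤ) | m) : ℤ) : ZMod p) = 1) : BSDp W p :=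
  bsdp_of_plusSymbolLevelLowersOver_of_tamagawa_le_two_of_shaAn_unit_of_kim2025_OPEN W p hK25s hCT hGZK
    hmod hp3 hr htower D hN hper hq' hv
    (plusSymbolLevelLowersOver_of_jacobiTwist_of_multiplicityOne p ι W D.f hmN hf₀ hQ hΩ hint θ hθ
      hθW c₀ hc₀ hsym hMO hℓ hOLD hμ hH hw) hℓN hc2

end Summit.BirchSwinnertonDyer.Rank1Residual.X4

end
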